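import Mathlib
import Literature.Combinatorics.Optimization.LpFormulationReductions
import Literature.Barriers.PneNP.TSPExtensionComplexityKaibelWeltge
import HarnessLib

/-!
# LP formulation complexity of maximum independent set, uniform model (Braun–Pokutta–Zink 2015, Example 3.10, exact case)

G. Braun, S. Pokutta, D. Zink, *Inapproximability of combinatorial problems via small LPs and SDPs*, STOC 2015
[BraunPokuttaZink2015] (held `paper:arxiv-1410.8816`, §3.1.2 "Independent set problem", p. 11–12), **Example 3.10
(Maximum independent set problem (uniform model))**: "feasible solutions … all subsets `S` of `[n]`, and the instances … all
`G ∈ 𝒢` [graphs with `V(G) ⊆ [n]`] … `val_G(S) := |V(G) ∩ S| − |E(G(S))|` … `α(G) = max_S val_G(S)` … guarantees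
`S(G) := max val_G = α(G)` and `C(G) := ρ^{-1} val_G` … Restricting to complete graphs `K_U` with `U ⊆ [n]`, the obtained
slack matrix is a `(ρ^{-1} − 1)`-shift of the (partial) unique disjointness matrix, hence for approximations within a
factor of `ρ`, we obtain the lower bound `fc(𝒫, C, max) ≥ 2^{nρ/8}` with [Braverman–Moitra, Braun–Pokutta]."

PROVED here, the EXACT endpoint `ρ = 1` (no shift), with the covering bound of V. Kaibel, S. Weltge [KaibelWeltge2014, Thm. 1]
(a TREE THEOREM, `Literature.Barriers.PneNP.IsKWValid.card_le_two_pow`) in place of [Braverman–Moitra] (not in the tree; it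
is what the printed `ρ < 1` cases need).  No named facts:

* `isProblem n` — the printed problem at `ρ = 1` (`C = S = max val = α`), instances the subgraphs of `K_n` (= graphs with
  `V(G) ⊆ [n]`), `isVal G X = |V(G) ∩ X| − |E(G[X])|` with `|E(G[X])|` counted as half the number of ordered adjacent pairs
  in `X` (`twiceEdgesIn`).
* `completeOn U` = `K_U`; `isVal_completeOn` (`val_{K_U}(X) = t − t(t−1)/2`, `t = |U ∩ X|`), `sSup_isVal_completeOn`
  (`α(K_U) = 1`), **`slack_completeOn`**: `S(K_U, X) = (t−1)(t−2)/2` — the partial unique-disjointness pattern: `1` at disjoint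
  pairs, `0` at `|U ∩ X| = 1`.
* **`three_pow_le_of_hasNonnegFactorization_is`** — `nnr(S) ≥ (3ⁿ − 2ⁿ)/2ⁿ`: every nonnegative rank-one term of a
  factorization vanishes where `S` does, so the disjoint pairs `(U, X)`, `U ≠ ∅`, in its support form a Kaibel–Weltge valid
  set (`≤ 2ⁿ` of them), and the `3ⁿ − 2ⁿ` such pairs (`card_disjPairs_fst_nonempty`) must be covered;
  **`is_lpFormulation_lower`** — no LP formulation of size `R` with `(R+2)·2ⁿ < 3ⁿ` (LP factorization theorem of
  `LpFormulationReductions.lean`).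

Recorded deviations: only `ρ = 1` (the printed `2^{nρ/8}` for `ρ < 1` rests on the shifted-UDISJ bound of Braverman–Moitra);
at `ρ = 1` the Kaibel–Weltge count gives the sharper `1.5ⁿ`-type bound stated here.
-/

noncomputable section

open Finset
open scoped Classical

namespace Literature.Combinatorics.Optimization

open Literature.Barriers.PneNP (disjPairs mem_disjPairs IsKWValid disjPairs_filter_fst_eq card_disjPairs)

variable {n : ℕ}

/-! ### The problem (uniform model) -/

/-- Twice the number of edges of `G` inside `X`: `#{(x,y) ∈ X × X : xy ∈ E(G)}` (ordered pairs; `|E(G[X])|` is half of it).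
[cite: BraunPokuttaZink2015, Ex. 3.10 (§3.1.2)] -/
def twiceEdgesIn (G : (⊤ : SimpleGraph (Fin n)).Subgraph) (X : Finset (Fin n)) : ℕ :=
  ((X ×ˢ X).filter fun p => G.Adj p.1 p.2).card

/-- **Example 3.10, the objective** `val_G(X) = |V(G) ∩ X| − |E(G[X])|` ("the number of vertices of `G` in `X` penalized by the
number of edges of `G` inside `X`"; `|E(G[X])| = ½·#{(x,y) ∈ X² : xy ∈ E(G)}`). [cite: BraunPokuttaZink2015, Ex. 3.10 (§3.1.2)] -/
def isVal (G : (⊤ : SimpleGraph (Fin n)).Subgraph) (X : Finset (Fin n)) : ℝ :=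
  ((univ.filter fun v => v ∈ G.verts ∧ v ∈ X).card : ℝ) - (twiceEdgesIn G X : ℝ) / 2

/-- **Example 3.10 (Maximum independent set problem, uniform model), exact guarantees**: feasible solutions all subsets
`X ⊆ [n]`, instances all graphs `G` with `V(G) ⊆ [n]` (subgraphs of `K_n`), objective `isVal`, and
`C(G) = S(G) = max_X val_G(X) = α(G)` (the printed `C(G) = ρ^{-1} val` at `ρ = 1`).
[cite: BraunPokuttaZink2015, Ex. 3.10 (§3.1.2)] -/
def isProblem (n : ℕ) : MaxProblem (Finset (Fin n)) ((⊤ : SimpleGraph (Fin n)).Subgraph) where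
  val := isVal
  C G := sSup (Set.range (isVal G))
  S G := sSup (Set.range (isVal G))

/-- Every instance is sound. [cite: BraunPokuttaZink2015, Ex. 3.10] -/
theorem isProblem_sound (G : (⊤ : SimpleGraph (Fin n)).Subgraph) : (isProblem n).Sound G :=
  fun X => le_csSup (Set.finite_range (isVal G)).bddAbove ⟨X, rfl⟩

/-! ### The rows `K_U`: a partial unique-disjointness matrix -/

/-- The complete graph `K_U` on `U ⊆ [n]`. [cite: BraunPokuttaZink2015, Ex. 3.10 ("Restricting to complete graphs `K_U`")] -/
def completeOn (U : Finset (Fin n)) : (⊤ : SimpleGraph (Fin n)).Subgraph :=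
  (⊤ : (⊤ : SimpleGraph (Fin n)).Subgraph).induce ↑U

/-- Adjacency in `K_U`. [folklore] -/
private theorem completeOn_adj (U : Finset (Fin n)) (x y : Fin n) :
    (completeOn U).Adj x y ↔ x ∈ U ∧ y ∈ U ∧ x ≠ y := by
  simp [completeOn, SimpleGraph.Subgraph.induce_adj]

/-- `val_{K_U}(X) = t − t(t−1)/2` with `t = |U ∩ X|`. [cite: BraunPokuttaZink2015, Ex. 3.10] -/
theorem isVal_completeOn (U X : Finset (Fin n)) :
    isVal (completeOn U) X = ((U ∩ X).card : ℝ) - ((U ∩ X).card : ℝ) * (((U ∩ X).card : ℝ) - 1) / 2 := by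
  unfold isVal twiceEdgesIn
  have h1 : (univ.filter fun v => v ∈ (completeOn U).verts ∧ v ∈ X) = U ∩ X := by
    ext v; simp [completeOn]
  have h2 : ((X ×ˢ X).filter fun p => (completeOn U).Adj p.1 p.2) = (U ∩ X).offDiag := by
    ext p
    simp only [mem_filter, mem_product, completeOn_adj, mem_offDiag, mem_inter]
    tauto
  rw [h1, h2, offDiag_card]
  have hle : (U ∩ X).card ≤ (U ∩ X).card * (U ∩ X).card := Nat.le_mul_self _
  push_cast [Nat.cast_sub hle]
  ring

/-- An integer `t` has `(t−1)(t−2) ≥ 0`. [folklore] -/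
private theorem sub_one_mul_sub_two_nonneg (t : ℕ) : (0 : ℝ) ≤ ((t : ℝ) - 1) * ((t : ℝ) - 2) := by
  rcases Nat.lt_or_ge t 2 with h | h
  · interval_cases t <;> norm_num
  · have : (2 : ℝ) ≤ t := by exact_mod_cast h
    exact mul_nonneg (by linarith) (by linarith)

/-- `max val_{K_U} = α(K_U) = 1` for `U ≠ ∅`. [cite: BraunPokuttaZink2015, Ex. 3.10] -/
theorem sSup_isVal_completeOn (U : Finset (Fin n)) (hU : U.Nonempty) : sSup (Set.range (isVal (completeOn U))) = 1 := by
  obtain ⟨u₀, hu₀⟩ := hU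
  refine IsGreatest.csSup_eq ⟨⟨{u₀}, ?_⟩, ?_⟩
  · rw [isVal_completeOn, inter_singleton_of_mem hu₀, card_singleton]; norm_num
  · rintro _ ⟨X, rfl⟩
    rw [isVal_completeOn]
    nlinarith [sub_one_mul_sub_two_nonneg (U ∩ X).card]

/-- **The slack matrix on the rows `K_U`** ("a (`ρ^{-1} − 1`)-shift of the (partial) unique disjointness matrix", here
`ρ = 1`): `S(K_U, X) = 1 − t + t(t−1)/2 = (t−1)(t−2)/2`, `t = |U ∩ X|` — `1` at disjoint pairs, `0` at `|U ∩ X| = 1`.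
[cite: BraunPokuttaZink2015, Ex. 3.10] -/
theorem slack_completeOn (U : Finset (Fin n)) (hU : U.Nonempty) (X : Finset (Fin n)) :
    (isProblem n).slackMatrix ⟨completeOn U, isProblem_sound _⟩ X =
      (((U ∩ X).card : ℝ) - 1) * (((U ∩ X).card : ℝ) - 2) / 2 := by
  simp only [MaxProblem.slackMatrix_apply, isProblem, sSup_isVal_completeOn U hU, isVal_completeOn]
  ring

/-! ### Kaibel–Weltge covering and the bound `nnr ≥ 1.5ⁿ − 1` -/

/-- The disjoint pairs `(U, X)` with `U ≠ ∅`: `3ⁿ − 2ⁿ` of them. [cite: KaibelWeltge2014, Thm. 1 (proof: `|disjpairs(n)| = 3ⁿ`)] -/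
theorem card_disjPairs_fst_nonempty (n : ℕ) :
    ((disjPairs (univ : Finset (Fin n))).filter fun p => p.1.Nonempty).card = 3 ^ n - 2 ^ n := by
  have htot := card_disjPairs (univ : Finset (Fin n))
  rw [card_univ, Fintype.card_fin] at htot
  have hempty : ((disjPairs (univ : Finset (Fin n))).filter fun p => ¬ p.1.Nonempty).card = 2 ^ n := by
    have : ((disjPairs (univ : Finset (Fin n))).filter fun p => ¬ p.1.Nonempty) =
        (disjPairs (univ : Finset (Fin n))).filter fun p => p.1 = ∅ := by
      ext p; simp only [mem_filter, not_nonempty_iff_eq_empty]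
    rw [this, disjPairs_filter_fst_eq (empty_subset _), card_image_of_injective _ fun b b' h => (Prod.ext_iff.1 h).2,
      card_powerset, sdiff_empty, card_univ, Fintype.card_fin]
  have hsum := card_filter_add_card_filter_not (s := disjPairs (univ : Finset (Fin n))) (fun p => p.1.Nonempty)
  rw [htot, hempty] at hsum
  omega

/-- **Example 3.10 (exact case), the lower bound via Kaibel–Weltge**: a nonnegative factorization of size `r` of the slack
matrix of the exact independent-set problem in the uniform model forces `3ⁿ ≤ (r+1)·2ⁿ` (`nnr ≥ 1.5ⁿ − 1`): on the rows `K_U`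
the slack is `1` at disjoint pairs and `0` at `|U ∩ X| = 1`, so the disjoint pairs (with `U ≠ ∅`) in the support of one
rank-one term form a valid set of size `≤ 2ⁿ` (the TREE THEOREM `IsKWValid.card_le_two_pow`), and `3ⁿ − 2ⁿ` pairs are covered.
[cite: BraunPokuttaZink2015, Ex. 3.10] [cite: KaibelWeltge2014, Thm. 1] -/
theorem three_pow_le_of_hasNonnegFactorization_is {r : ℕ} (h : HasNonnegFactorization (isProblem n).slackMatrix r) :
    3 ^ n ≤ (r + 1) * 2 ^ n := by
  obtain ⟨U', V, hU', hV, hM⟩ := h.submatrix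
    (fun U : {U : Finset (Fin n) // U.Nonempty} => ⟨completeOn U.1, isProblem_sound _⟩) (fun X : Finset (Fin n) => X)
  have hS : ∀ (U : {U : Finset (Fin n) // U.Nonempty}) (X : Finset (Fin n)),
      (((U.1 ∩ X).card : ℝ) - 1) * (((U.1 ∩ X).card : ℝ) - 2) / 2 = ∑ l, U' U l * V l X := fun U X => by
    rw [← slack_completeOn U.1 U.2 X]; exact hM U X
  set D := (disjPairs (univ : Finset (Fin n))).filter fun p => p.1.Nonempty with hD
  let Rl : Fin r → Finset (Finset (Fin n) × Finset (Fin n)) := fun l =>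
    D.filter fun p => ∃ h : p.1.Nonempty, 0 < U' ⟨p.1, h⟩ l ∧ 0 < V l p.2
  have hcover : D ⊆ univ.biUnion Rl := by
    intro p hp
    have hp' := mem_filter.1 hp
    have hpn : p.1.Nonempty := hp'.2
    have hdisj : Disjoint p.1 p.2 := (mem_disjPairs.1 hp'.1).2.2
    have h1 : (1 : ℝ) = ∑ l, U' ⟨p.1, hpn⟩ l * V l p.2 := by
      have := hS ⟨p.1, hpn⟩ p.2
      rw [disjoint_iff_inter_eq_empty.1 hdisj, card_empty] at this
      norm_num at this
      linarith
    obtain ⟨l, -, hl⟩ : ∃ l ∈ (univ : Finset (Fin r)), 0 < U' ⟨p.1, hpn⟩ l * V l p.2 := by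
      by_contra hcon
      have hcon' : ∀ l ∈ (univ : Finset (Fin r)), U' ⟨p.1, hpn⟩ l * V l p.2 ≤ 0 :=
        fun l hl => not_lt.1 fun h' => hcon ⟨l, hl, h'⟩
      have : ∑ l, U' ⟨p.1, hpn⟩ l * V l p.2 ≤ 0 := sum_nonpos hcon'
      linarith
    have hUl : 0 < U' ⟨p.1, hpn⟩ l :=
      lt_of_le_of_ne (hU' _ _) fun h0 => by rw [← h0, zero_mul] at hl; exact lt_irrefl _ hl
    have hVl : 0 < V l p.2 :=
      lt_of_le_of_ne (hV _ _) fun h0 => by rw [← h0, mul_zero] at hl; exact lt_irrefl _ hl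
    exact mem_biUnion.2 ⟨l, mem_univ l, mem_filter.2 ⟨hp, hpn, hUl, hVl⟩⟩
  have hvalid : ∀ l, IsKWValid (Rl l) := by
    intro l p hp q hq hcard
    obtain ⟨-, hpn, hUp, -⟩ := mem_filter.1 hp
    obtain ⟨-, hqn, -, hVq⟩ := mem_filter.1 hq
    have h0 : (0 : ℝ) = ∑ l', U' ⟨p.1, hpn⟩ l' * V l' q.2 := by
      have := hS ⟨p.1, hpn⟩ q.2
      rw [hcard] at this
      norm_num at this
      linarith
    have hle : U' ⟨p.1, hpn⟩ l * V l q.2 ≤ ∑ l', U' ⟨p.1, hpn⟩ l' * V l' q.2 :=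
      single_le_sum (f := fun l' => U' ⟨p.1, hpn⟩ l' * V l' q.2) (fun l' _ => mul_nonneg (hU' _ _) (hV _ _))
        (mem_univ l)
    have hpos : 0 < U' ⟨p.1, hpn⟩ l * V l q.2 := mul_pos hUp hVq
    linarith
  have hRsub : ∀ l, Rl l ⊆ disjPairs (univ : Finset (Fin n)) := fun l p hp =>
    (mem_filter.1 (mem_filter.1 hp).1).1
  have hRcard : ∀ l, (Rl l).card ≤ 2 ^ n := fun l => by
    have := IsKWValid.card_le_two_pow (univ : Finset (Fin n)) (Rl l) (hvalid l) (hRsub l)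
    rwa [card_univ, Fintype.card_fin] at this
  have hDcard : D.card = 3 ^ n - 2 ^ n := card_disjPairs_fst_nonempty n
  have hcount : 3 ^ n - 2 ^ n ≤ r * 2 ^ n := by
    rw [← hDcard]
    calc D.card ≤ (univ.biUnion Rl).card := card_le_card hcover
      _ ≤ ∑ l, (Rl l).card := card_biUnion_le
      _ ≤ ∑ _l : Fin r, 2 ^ n := sum_le_sum fun l _ => hRcard l
      _ = r * 2 ^ n := by rw [sum_const, card_univ, Fintype.card_fin, smul_eq_mul]
  have h23 : 2 ^ n ≤ 3 ^ n := Nat.pow_le_pow_left (by norm_num) n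
  rw [add_mul, one_mul]
  omega

/-- **Example 3.10 (exact case) at formulation level**: the exact maximum-independent-set problem in the uniform model on
`[n]` has no LP formulation of size `R` with `(R + 2)·2ⁿ < 3ⁿ`, i.e. `fc ≥ 1.5ⁿ − 2` (printed for approximation factors
`ρ`: `fc ≥ 2^{nρ/8}` via [Braverman–Moitra]; here the exact endpoint with the sharper Kaibel–Weltge count).
[cite: BraunPokuttaZink2015, Ex. 3.10] [cite: KaibelWeltge2014, Thm. 1] -/
theorem is_lpFormulation_lower {R : ℕ} (hR : (R + 2) * 2 ^ n < 3 ^ n) : IsEmpty (LPFormulation (isProblem n) R) :=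
  LPFormulation.isEmpty_of_not_hasNonnegFactorization fun h => by
    have h' := three_pow_le_of_hasNonnegFactorization_is h
    rw [show R + 1 + 1 = R + 2 from rfl] at h'
    exact absurd (lt_of_lt_of_le hR h') (lt_irrefl _)

end Literature.Combinatorics.Optimization

end
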